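import Literature.NumberTheory.Automorphic.Liu2021.AppendixC.AlbaneseFunctorial
import HarnessLib

/-!
# Liu 2021, App. C l. 4656 / Def. C.8 and §4.2 in the Compact Case: `X_K = Sh(𝕍)_K`, and the standing datum from
# smoothness, projectivity and the Albanese data alone

[Liu2021] = Yifeng Liu, *Fourier–Jacobi cycles and arithmetic relative trace formula*, Cambridge J. Math. **9** (2021),
no. 1, 1–147 = arXiv:2102.11518; TeX lines `l. NNNN` refer to the author's source `FJcycle.tex` of the arXiv v2 e-print
(md5 `6db49a74122d2cb0f224fa1b39488a0c`), exactly as in `AppendixC/Glue.lean`.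

## The printed text (verbatim, TeX macros resolved)

**App. C, l. 4656** (before Def. C.8): «The scheme `Sh(𝕍)_K` (for `K` sufficiently small) is quasi-projective and smooth
over `E` of dimension `n − 1`. It is projective if `d > 1` or `n = 1`. In all cases, we denote by `\overline{Sh}(𝕍)_K` the
Baily–Borel compactification of `Sh(𝕍)_K` over `E`. […] Let `S̃h(𝕍)_K` be the blow-up of `\overline{Sh}(𝕍)_K` along
`\overline{Sh}(𝕍)_K ∖ Sh(𝕍)_K`. If `Sh(𝕍)_K` is proper, then `S̃h(𝕍)_K = Sh(𝕍)_K`.»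

**§4.2, l. 2055–2062**: «We say that we are in the *Noncompact Case* if `d = 1`, and either `n ≥ 3` or […]; in the
*Compact Case* if it is not in the Noncompact Case. […] it is projective if and only if we are in the Compact Case. […]
Put `X_K := S̃h(𝕍)_K` for short.»

## What this file does

`AppendixC/Glue.lean` (p293186) records the compactified Shimura varieties `X_K = S̃h(𝕍)_K` as the carrier structure
`CompactifiedSystem S` (:297) and the standing data of §4.2 as `Sec42Data P5 isotropicAt` (:353), both POSITED by
their consumers.  Here, with NO new mathematics:

* `CompactifiedSystem.ofProjective S smooth proj` — when every `Sh(𝕍)_K` is smooth of relative dimension `n − 1` and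
  projective over `E` (the printed attributes of l. 4656 in the case «`d > 1`»), the compactified system with
  `\overline{Sh}(𝕍)_K := S̃h(𝕍)_K := Sh(𝕍)_K`, all comparison maps identities, empty boundary («If `Sh(𝕍)_K` is proper,
  then `S̃h(𝕍)_K = Sh(𝕍)_K`», l. 4656);
* `Sec42Data.ofCompactCase` — for `d = [F : ℚ] ≠ 1` (so that we are in the Compact Case whatever `isotropicAt` says,
  l. 2055–2057), the standing datum of §4.2 from `(2 ≤ n, S, smooth, proj, alb)` ALONE: the compactified system is
  `ofProjective`, the transition morphisms `∇u`, `Alb_u` are the kernel constructions of `AppendixC/AlbaneseFunctorial.lean`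
  (`Sec42Data.ofAlbanese`), and `alb K : Albanese (Sh(𝕍)_K)` is the ONLY input beyond the Shimura system and its two
  printed attributes; `Sec42Data.isCompactCase_ofCompactCase` records that the datum is in the Compact Case.

Nothing is asserted: no existence of Shimura varieties, of Albanese varieties, no smoothness or projectivity is
claimed — all are inputs.  No named facts; axioms ⊆ {propext, Classical.choice, Quot.sound}.

## References

* [Liu2021] Y. Liu, *Fourier–Jacobi cycles and arithmetic relative trace formula*, Camb. J. Math. 9 (2021) 1–147,
  arXiv:2102.11518 — App. C l. 4656, Def. C.8 (l. 4663–4665); §4.2 l. 2053–2070; Def. 2.1 (1), Def. 2.3.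

## Provenance

pub-hodgecm2 (COR-CM cell), seat b11 gen 56, TEAM hComp side object for referee ruling R-2 («everything else of
`Sec42Data` IS constructible from the record in the Compact Case … `cpt` with `X := Sh𝕍`, `j := 𝟙`, `ShBar := Sh𝕍`, empty
boundary»), sequel of `AppendixC/AlbaneseFunctorial.lean`; count-neutral.
-/

noncomputable section

open CategoryTheory CategoryTheory.Limits AlgebraicGeometry MonoidalCategory CartesianMonoidalCategory NumberField
open Literature.AlgebraicGeometry.Motives (SchemeOver AbelianVariety IsProjectiveOver)

namespace Literature.NumberTheory.Automorphic.Liu2021.AppendixC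

variable {F E : Type} [Field F] [NumberField F] [IsTotallyReal F] [Field E] [NumberField E] [Algebra F E]
  [IsTotallyComplex E] [Algebra.IsQuadraticExtension F E]

/-! ## App. C l. 4656 / Def. C.8 when every `Sh(𝕍)_K` is projective: `X_K = Sh(𝕍)_K` -/

namespace CompactifiedSystem

variable {D : PropC5Data F E}

/-- **`S̃h(𝕍)_K = Sh(𝕍)_K` when `Sh(𝕍)_K` is projective** (App. C l. 4656: «It is projective if `d > 1` or `n = 1`. […]
If `Sh(𝕍)_K` is proper, then `S̃h(𝕍)_K = Sh(𝕍)_K`»; Def. C.8): the compactified system whose Baily–Borel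
compactification, blow-up and compactified variety are ALL `Sh(𝕍)_K` itself, with identity comparison maps and EMPTY
boundary, given — as inputs, the printed attributes of l. 4656 — that every `Sh(𝕍)_K` is smooth over `E` of relative
dimension `n − 1` and projective over `E`. [cite: Liu2021, App. C l. 4656 and Def. C.8 (l. 4663–4665)] -/
def ofProjective (S : IncoherentShimuraSystem D)
    (smooth : ∀ K : C5.SmallLevel S.K₀, SmoothOfRelativeDimension (D.n - 1) (S.Sh𝕍.obj K).hom)
    (proj : ∀ K : C5.SmallLevel S.K₀, IsProjectiveOver (S.Sh𝕍.obj K)) : CompactifiedSystem S where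
  ShBar K := S.Sh𝕍.obj K
  jBar K := 𝟙 _
  isOpenImmersion_jBar K := by
    rw [Over.id_left]
    infer_instance
  discrete_boundary K := by
    haveI : Subsingleton ↥(Set.range fun x : ↥(S.Sh𝕍.obj K).left => (𝟙 (S.Sh𝕍.obj K) : _ ⟶ _).left.base x)ᶜ :=
      ⟨fun a _ => (a.2 ⟨a.1, by simp⟩).elim⟩
    infer_instance
  X := S.Sh𝕍
  blowDown K := 𝟙 _
  j := 𝟙 S.Sh𝕍
  j_blowDown K := by rw [NatTrans.id_app, Category.comp_id]
  isOpenImmersion_j K := by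
    rw [NatTrans.id_app, Over.id_left]
    infer_instance
  isIso_j_of_isProper K _ := by
    rw [NatTrans.id_app]
    infer_instance
  smooth_Sh := smooth
  projective_Sh_of _ := proj
  smooth_X := smooth
  projective_X := proj

/-- The compactified varieties of `ofProjective` are the Shimura varieties themselves: `X = Sh(𝕍)` as projective systems
(by `rfl`). [cite: Liu2021, App. C l. 4656] -/
@[simp] theorem ofProjective_X (S : IncoherentShimuraSystem D) (smooth) (proj) :
    (ofProjective S smooth proj).X = S.Sh𝕍 := rfl

/-- `\overline{Sh}(𝕍)_K = Sh(𝕍)_K` in `ofProjective` (by `rfl`). [cite: Liu2021, App. C l. 4656] -/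
@[simp] theorem ofProjective_ShBar (S : IncoherentShimuraSystem D) (smooth) (proj) (K : C5.SmallLevel S.K₀) :
    (ofProjective S smooth proj).ShBar K = S.Sh𝕍.obj K := rfl

/-- The open immersions `Sh(𝕍)_K ↪ X_K` of `ofProjective` are the identity natural transformation (by `rfl`).
[cite: Liu2021, App. C l. 4656] -/
@[simp] theorem ofProjective_j (S : IncoherentShimuraSystem D) (smooth) (proj) :
    (ofProjective S smooth proj).j = 𝟙 S.Sh𝕍 := rfl

end CompactifiedSystem

/-! ## §4.2 in the Compact Case `d ≠ 1`: the standing datum from `(2 ≤ n, S, smooth, proj, alb)` -/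

namespace Sec42Data

variable {P5 : PropC5Data F E} {isotropicAt : ℕ → Prop}

/-- **The standing data of §4.2 in the Compact Case `d = [F : ℚ] ≠ 1`** (l. 2053–2070 with App. C l. 4656): from
«`n ≥ 2`», a system of Shimura varieties for `𝕍` (Def. C.6), the printed attributes «smooth over `E` of dimension
`n − 1`» and «projective» of every `Sh(𝕍)_K` (l. 4656, case `d > 1`), and Albanese data `alb K` for every `X_K = Sh(𝕍)_K`
(Def. 2.3) — NOTHING ELSE: `X_K := Sh(𝕍)_K` (`CompactifiedSystem.ofProjective`), «it is projective if and only if we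
are in the Compact Case» holds because both sides are true for `d ≠ 1`, and `∇u^{K'}_K`, `Alb_{u^{K'}_K}` with their
identities are the kernel constructions `Nabla.map`, `Albanese.map` (`Sec42Data.ofAlbanese`).
[cite: Liu2021, §4.2 l. 2053–2070; App. C l. 4656; Def. 2.1 (1), Def. 2.3] -/
def ofCompactCase (two_le_n : 2 ≤ P5.n) (S : IncoherentShimuraSystem P5) (hd : Module.finrank ℚ F ≠ 1)
    (smooth : ∀ K : C5.SmallLevel S.K₀, SmoothOfRelativeDimension (P5.n - 1) (S.Sh𝕍.obj K).hom)
    (proj : ∀ K : C5.SmallLevel S.K₀, IsProjectiveOver (S.Sh𝕍.obj K))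
    (alb : ∀ K : C5.SmallLevel S.K₀, Albanese (S.Sh𝕍.obj K)) : Sec42Data P5 isotropicAt :=
  ofAlbanese two_le_n S (fun K => ⟨fun _ h => hd h.1, fun _ => proj K⟩)
    (CompactifiedSystem.ofProjective S smooth proj) alb

/-- The Shimura system of `ofCompactCase` is the given one (by `rfl`). [cite: Liu2021, §4.2 l. 2060] -/
@[simp] theorem ofCompactCase_S (two_le_n : 2 ≤ P5.n) (S : IncoherentShimuraSystem P5) (hd : Module.finrank ℚ F ≠ 1)
    (smooth) (proj) (alb : ∀ K : C5.SmallLevel S.K₀, Albanese (S.Sh𝕍.obj K)) :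
    (ofCompactCase (isotropicAt := isotropicAt) two_le_n S hd smooth proj alb).S = S := rfl

/-- `X_K = Sh(𝕍)_K` in `ofCompactCase` (by `rfl`). [cite: Liu2021, §4.2 l. 2062; App. C l. 4656] -/
theorem ofCompactCase_X (two_le_n : 2 ≤ P5.n) (S : IncoherentShimuraSystem P5) (hd : Module.finrank ℚ F ≠ 1)
    (smooth) (proj) (alb : ∀ K : C5.SmallLevel S.K₀, Albanese (S.Sh𝕍.obj K)) (K : C5.SmallLevel S.K₀) :
    (ofCompactCase (isotropicAt := isotropicAt) two_le_n S hd smooth proj alb).X K = S.Sh𝕍.obj K := rfl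

/-- `A_K = Alb_{Sh(𝕍)_K}` in `ofCompactCase`: the abelian variety of the given Albanese datum (by `rfl`).
[cite: Liu2021, §4.2 l. 2066] -/
theorem ofCompactCase_A (two_le_n : 2 ≤ P5.n) (S : IncoherentShimuraSystem P5) (hd : Module.finrank ℚ F ≠ 1)
    (smooth) (proj) (alb : ∀ K : C5.SmallLevel S.K₀, Albanese (S.Sh𝕍.obj K)) (K : C5.SmallLevel S.K₀) :
    (ofCompactCase (isotropicAt := isotropicAt) two_le_n S hd smooth proj alb).A K = (alb K).Alb := rfl

/-- `Alb_{u^{K'}_K}` in `ofCompactCase` is `Albanese.map` at the transition morphism of the Shimura system (by `rfl`).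
[cite: Liu2021, §4.2 l. 2070; Def. 2.3] -/
theorem ofCompactCase_Atr (two_le_n : 2 ≤ P5.n) (S : IncoherentShimuraSystem P5) (hd : Module.finrank ℚ F ≠ 1)
    (smooth) (proj) (alb : ∀ K : C5.SmallLevel S.K₀, Albanese (S.Sh𝕍.obj K)) {K K' : C5.SmallLevel S.K₀}
    (f : K' ⟶ K) :
    (ofCompactCase (isotropicAt := isotropicAt) two_le_n S hd smooth proj alb).Atr f =
      (alb K').map (alb K) (S.Sh𝕍.map f) := rfl

/-- The datum `ofCompactCase` IS in the Compact Case (l. 2057: `d ≠ 1` excludes the Noncompact Case).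
[cite: Liu2021, §4.2 l. 2053–2057] -/
theorem isCompactCase_ofCompactCase (two_le_n : 2 ≤ P5.n) (S : IncoherentShimuraSystem P5)
    (hd : Module.finrank ℚ F ≠ 1) (smooth) (proj) (alb : ∀ K : C5.SmallLevel S.K₀, Albanese (S.Sh𝕍.obj K)) :
    (ofCompactCase (isotropicAt := isotropicAt) two_le_n S hd smooth proj alb).IsCompactCase :=
  fun h => hd h.1

end Sec42Data

end Literature.NumberTheory.Automorphic.Liu2021.AppendixC

end
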